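import Summits.NavierStokesRegularity.NavierStokesRegularity.Theorems.PalasekTowerBreakdownSupGrowth
import Summits.NavierStokesRegularity.NavierStokesRegularity.Cruxes.HeredityAtOne.StrategyCensus

/-!
# STRATEGY CENSUS v3 — kernel spine of the SLACK MAP for crux `HeredityAtOne` (item stmt-NavierStokesRegularity-19249)

Cell `ns-blowup`, seat `ns-palasek-19249-cstrat-1` (g2; planner, CRUX-STRATEGIST alongside the lead of record
`ecbridge-1` g7). Companion of `Cruxes/HeredityAtOne/STRATEGY-CENSUS.md` §v3 ADDENDUM and of the v2 spine
`Cruxes/HeredityAtOne/StrategyCensus.lean` (g0). It composes BY NAME the lead's register-free amplification predicate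
(`FluidComputer/PalasekTowerSupGrowth.lean`: `SupGrowthBound ν A T M`, `aprioriCeilingAt_of_supGrowthBound`;
`Theorems/PalasekTowerBreakdownSupGrowth.lean`) with the v2 vacuity / slice vocabulary (`NoLevelOne`,
`SliceHeredityAtOne`). LABEL: E–C typing (KERNEL: equivalences and implications between OPEN statements; the one
re-proof sharpens a window constant `(3/2)·W₁ → W₁` under rigidity). WHAT THIS IS NOT: not Navier–Stokes evidence —
nothing is constructed, no item is proved, refuted, claimed or re-split; `SupGrowthBound` beyond Leray's window is OPEN
and appears only as a hypothesis.

## What is proved (wide rates; `c₁ = 1`, `c₂ = 5/3`, `W₁ = TowerRates.wide.window 1`)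

* R1 (the floors' axis): `SupGrowthBound 1 (c₂Y₁) W₁ M → M·c₂Y₁ < Y₂ → (crux ↔ NoLevelOne)` and `(crux ↔ ¬EpisodeBase)`
  — under a universal small-amplification bound (factor `< Y₂/(c₂Y₁) ≈ 1.326` within the rigid window itself, not
  `3/2` windows) the crux is EXACTLY vacuity, i.e. exactly the failure of the sibling binder 19179; numeric instance
  `M = 1.325` (`speedFloor_two_growth_factors`). The re-proof `not_supGrowthBound_window_of_base_crux` is the lead's
  `palasekTowerBreakdown_not_supGrowthBound_of_base_heredityAtOne` with `Schedule.Rigid.gap_eq_window` in place of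
  the generic `τ_sub_τ_le_window` (a WEAKER hypothesis refuted, hence a stronger statement).
* R2 (the upper stub's axis): `SupGrowthBound 1 (c₂Y₁) W₁ M → M·c₂Y₁ ≤ c₂Y₂ → (crux ↔ SpeedFloorAt 1 ∧ StrainFloorAt 1
  ∧ CoreFloorAt 1)` — under the lead's bound the crux IS its three floors.
* Sandwich: `SupGrowthBound 1 (c₂Y₁) W₁ M → M·c₂Y₁ ≤ c₂Y₂ → SliceHeredityAtOne → crux` — the crux from two hypotheses
  neither of which mentions a registered stage (the first register-free, the second schedule-light, v2 (e)).
* S6 (the history class S⁺⁺): `HistoryEnvelopeOne`, `@[conjecture] HistoryHeredityAtOne` (CANDIDATE, never asserted),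
  `historyEnvelopeOne_of_stage`, S⁺ ⇒ S⁺⁺ (`historyHeredityAtOne_of_sliceHeredityAtOne`) ⇒ floors
  (`floors_of_historyHeredityAtOne`) ⇒ with the upper stub / the lead's bound, the crux; the refutation template
  `not_historyHeredityAtOne_of_abandoned_history` (E2's landing pad) and `lazy_history_not_registered`.

References: J. Leray, Acta Math. 63 (1934) §21 [cite: Leray1934, §21 (3.15) p. 226]; S. Palasek, arXiv:2605.13827
§3.3–§4 [cite: Palasek2026ElementaryModel, §4]; P. G. Lemarié-Rieusset, *The Navier–Stokes Problem in the 21st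
Century* (2016) §20.4 [cite: LemarieRieusset2016, §20.4].
-/

-- `Summit.<Summit>.<Problem>` is the tree's mandated summit-side namespace; the duplicate is deliberate.
set_option linter.dupNamespace false

noncomputable section

namespace Summit.NavierStokesRegularity.NavierStokesRegularity.Cruxes.HeredityAtOne.StrategyCensusG2

open Set MeasureTheory Filter Topology
open scoped ENNReal
open Summit.NavierStokesRegularity.NavierStokesRegularity.Theses
open Summit.NavierStokesRegularity.NavierStokesRegularity.Theorems
open Summit.NavierStokesRegularity.NavierStokesRegularity.Cruxes.HeredityAtOne.StrategyCensus
open Summit.NavierStokesRegularity.FluidComputer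
open Summit.NavierStokesRegularity.FluidComputer.PalasekTowerClayBridge
open Literature.Analysis.FluidPDE

/-! ## R1 — the floors' axis: small universal amplification makes the crux exactly vacuity -/

/-- **The two binders refute a small-amplification bound on the rigid window itself** (sharpening of the
lead's `palasekTowerBreakdown_not_supGrowthBound_of_base_heredityAtOne`, whose window is `(3/2)·W₁`): with
`EpisodeBase` and the crux, `SupGrowthBound 1 ((5/3)Y₁) (window 1) M` fails for every `M` with `M·(5/3)Y₁ < Y₂`.
Proof = the lead's, with `τ₂ − τ₁ = window 1` (`Schedule.Rigid.gap_eq_window`). [cite: Palasek2026ElementaryModel, §4] -/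
theorem not_supGrowthBound_window_of_base_crux
    (h₁ : PalasekTowerBreakdown.EpisodeBase) (h₂ : PalasekTowerBreakdown.HeredityAtOne) {M : ℝ}
    (hM : M * (5 / 3 * TowerRates.wide.Y 1) < TowerRates.wide.Y 2) :
    ¬ SupGrowthBound 1 (5 / 3 * TowerRates.wide.Y 1) (TowerRates.wide.window 1) M := by
  intro hG
  obtain ⟨S, -, hR, hQ, ⟨s⟩⟩ : RungG 2 := rungG_two_of_heredityAtOne h₁ h₂
  have hτ1 : 0 < S.τ 1 := S.τ_pos 1
  have h12 : S.τ 1 < S.τ 2 := S.τ_lt_succ 1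
  have hf : ∀ r, S.τ 1 ≤ r → S.f r = 0 := fun r hr => hQ r hr
  have hU : IsClassicalNSSolutionOn (Icc 0 (S.τ 2 - S.τ 1)) 1 0 (fun r => s.u (r + S.τ 1))
      (fun r => s.p (r + S.τ 1)) :=
    isClassicalNSSolutionOn_translate_of_silent s.classical hτ1.le h12 hf
  have hEU : ∃ C : ℝ≥0∞, C < ⊤ ∧ ∀ r ∈ Icc 0 (S.τ 2 - S.τ 1),
      ∫⁻ y, ‖s.u (r + S.τ 1) y‖ₑ ^ 2 ≤ C := by
    obtain ⟨C, hC, hb⟩ := s.energy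
    exact ⟨C, hC, fun r hr => hb (r + S.τ 1) ⟨by linarith [hr.1], by linarith [hr.2]⟩⟩
  have hU0 : ∀ y, ‖(fun r => s.u (r + S.τ 1)) 0 y‖ ≤ 5 / 3 * TowerRates.wide.Y 1 := by
    intro y
    simp only [zero_add]
    rw [← hR.c₂_eq]
    exact s.ceiling 1 (by norm_num) (S.τ 1) ⟨hτ1.le, le_rfl⟩ y
  have hlen : S.τ 2 - S.τ 1 ≤ TowerRates.wide.window 1 := le_of_eq (hR.gap_eq_window 1)
  obtain ⟨x₀, -, hfl⟩ := s.floor 2 le_rfl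
  have key := hG (by linarith) hlen _ _ hU hEU hU0 (S.τ 2 - S.τ 1) ⟨by linarith, le_rfl⟩ x₀
  simp only [sub_add_cancel] at key
  rw [hR.c₁_eq, one_mul] at hfl
  linarith

/-- **R1**: under `SupGrowthBound 1 ((5/3)Y₁) (window 1) M` with `M·(5/3)Y₁ < Y₂` the crux is EXACTLY the failure of
the sibling binder `EpisodeBase` (19179). [cite: Palasek2026ElementaryModel, §4] -/
theorem crux_iff_not_episodeBase_of_supGrowthBound {M : ℝ}
    (hG : SupGrowthBound 1 (5 / 3 * TowerRates.wide.Y 1) (TowerRates.wide.window 1) M)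
    (hM : M * (5 / 3 * TowerRates.wide.Y 1) < TowerRates.wide.Y 2) :
    PalasekTowerBreakdown.HeredityAtOne ↔ ¬ PalasekTowerBreakdown.EpisodeBase :=
  ⟨fun h hB => not_supGrowthBound_window_of_base_crux hB h hM hG,
    fun hB => crux_of_noLevelOne (noLevelOne_iff_not_episodeBase.2 hB)⟩

/-- **R1, vacuity form**: under the same bound the crux is EXACTLY `NoLevelOne` (no pinned rigid quiet wide design
registers a level-1 stage). [cite: Palasek2026ElementaryModel, §4] -/
theorem crux_iff_noLevelOne_of_supGrowthBound {M : ℝ}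
    (hG : SupGrowthBound 1 (5 / 3 * TowerRates.wide.Y 1) (TowerRates.wide.window 1) M)
    (hM : M * (5 / 3 * TowerRates.wide.Y 1) < TowerRates.wide.Y 2) :
    PalasekTowerBreakdown.HeredityAtOne ↔ NoLevelOne :=
  (crux_iff_not_episodeBase_of_supGrowthBound hG hM).trans noLevelOne_iff_not_episodeBase.symm

/-- **R1, numeric instance** (`1.325·(5/3)Y₁ < Y₂`, certified): a universal amplification bound by the factor
`1.325` within `Θ₁ = W₁·((5/3)Y₁)²` Kato units would make the crux exactly vacuity. [cite: Palasek2026ElementaryModel, §4] -/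
theorem crux_iff_noLevelOne_of_supGrowthBound_1325
    (hG : SupGrowthBound 1 (5 / 3 * TowerRates.wide.Y 1) (TowerRates.wide.window 1) 1.325) :
    PalasekTowerBreakdown.HeredityAtOne ↔ NoLevelOne :=
  crux_iff_noLevelOne_of_supGrowthBound hG speedFloor_two_growth_factors.1

/-- **R1 read on the route**: under such a bound the route's two level-1 binders are jointly inconsistent — the
line `PalasekTowerBreakdown` would be dead at `(19179, 19249)`. [cite: Palasek2026ElementaryModel, §4] -/
theorem not_base_and_crux_of_supGrowthBound {M : ℝ}
    (hG : SupGrowthBound 1 (5 / 3 * TowerRates.wide.Y 1) (TowerRates.wide.window 1) M)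
    (hM : M * (5 / 3 * TowerRates.wide.Y 1) < TowerRates.wide.Y 2) :
    ¬ (PalasekTowerBreakdown.EpisodeBase ∧ PalasekTowerBreakdown.HeredityAtOne) :=
  fun ⟨hB, h⟩ => not_supGrowthBound_window_of_base_crux hB h hM hG

/-! ## R2 — the upper stub's axis: under the lead's bound the crux IS its three floors -/

/-- **R2**: under `SupGrowthBound 1 ((5/3)Y₁) (window 1) M` with `M·(5/3)Y₁ ≤ (5/3)Y₂` (e.g. `M = Y₂/Y₁ ≈ 2.21`)
the upper stub is discharged (`aprioriCeilingAt_of_supGrowthBound`, lead g7) and the crux is equivalent to the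
conjunction of its three floors. [cite: Palasek2026ElementaryModel, §4] -/
theorem crux_iff_floors_of_supGrowthBound {M : ℝ}
    (hG : SupGrowthBound 1 (5 / 3 * TowerRates.wide.Y 1) (TowerRates.wide.window 1) M)
    (hM : M * (5 / 3 * TowerRates.wide.Y 1) ≤ 5 / 3 * TowerRates.wide.Y (1 + 1)) :
    PalasekTowerBreakdown.HeredityAtOne ↔ SpeedFloorAt 1 ∧ StrainFloorAt 1 ∧ CoreFloorAt 1 := by
  have hA : AprioriCeilingAt 1 := aprioriCeilingAt_of_supGrowthBound le_rfl hG hM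
  rw [crux_iff_four_stubs]
  exact ⟨fun h => h.2, fun h => ⟨hA, h⟩⟩

/-- **The two axes meet**: a bound small enough for R1 is small enough for R2, so under it the three floors are
themselves equivalent to vacuity. [cite: Palasek2026ElementaryModel, §4] -/
theorem floors_iff_noLevelOne_of_supGrowthBound {M : ℝ}
    (hG : SupGrowthBound 1 (5 / 3 * TowerRates.wide.Y 1) (TowerRates.wide.window 1) M)
    (hM : M * (5 / 3 * TowerRates.wide.Y 1) < TowerRates.wide.Y 2) :
    (SpeedFloorAt 1 ∧ StrainFloorAt 1 ∧ CoreFloorAt 1) ↔ NoLevelOne := by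
  have hY2 : 0 ≤ TowerRates.wide.Y (1 + 1) :=
    (Real.rpow_pos_of_pos (TowerRates.wide.N_pos (1 + 1)) _).le
  have hM' : M * (5 / 3 * TowerRates.wide.Y 1) ≤ 5 / 3 * TowerRates.wide.Y (1 + 1) := by
    have : TowerRates.wide.Y 2 ≤ 5 / 3 * TowerRates.wide.Y (1 + 1) := by
      show TowerRates.wide.Y (1 + 1) ≤ 5 / 3 * TowerRates.wide.Y (1 + 1)
      linarith
    exact hM.le.trans this
  rw [← crux_iff_floors_of_supGrowthBound hG hM']
  exact crux_iff_noLevelOne_of_supGrowthBound hG hM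

/-! ## Sandwich — the crux from two stage-free hypotheses -/

/-- **The crux from the lead's register-free bound and the v2 slice heredity S⁺** (`SliceHeredityAtOne`, schedule-light:
no registered stage in either hypothesis). Both hypotheses are OPEN and each is believed refutable at MODEL level
(census §v3 R2 resp. v2 (e)); the theorem records only that together they would suffice. [cite: Palasek2026ElementaryModel, §4] -/
theorem crux_of_supGrowthBound_sliceHeredity {M : ℝ}
    (hG : SupGrowthBound 1 (5 / 3 * TowerRates.wide.Y 1) (TowerRates.wide.window 1) M)
    (hM : M * (5 / 3 * TowerRates.wide.Y 1) ≤ 5 / 3 * TowerRates.wide.Y (1 + 1)) (hS : SliceHeredityAtOne) :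
    PalasekTowerBreakdown.HeredityAtOne :=
  crux_of_apriori_sliceHeredityAtOne (aprioriCeilingAt_of_supGrowthBound le_rfl hG hM) hS

/-! ## S6 — the HISTORY class S⁺⁺: strictly between S⁺ (`SliceHeredityAtOne`) and the crux

S⁺ quantifies over every slice in the level-1 ENVELOPE (letter + ceiling at `τ₁`); S⁺⁺ keeps in addition the one
parabolic HISTORY every registered slice provably carries — it is the time-`τ₁` value of a classical finite-energy
flow of the design's forced system that obeyed the level-0 ceiling/quiet clause on `[0, τ₀]`, the level-1 ceiling on
`[0, τ₁]`, and read the level-0 letter at `τ₀` — and still forgets exactly the registered data the census calls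
load-bearing: the initial datum `S.u₀` and the MARGIN `routeG` (global anchoring of the level-0 sup, hence the
×(Y₁/Y₀) ≈ 2.056 amplification in window 0; the core ledger). S⁺ ⇒ S⁺⁺ ⇒ the three floors; each arrow strict in
content. S⁺⁺ is a CANDIDATE, never asserted; the census (§v3 S6, experiment E2) predicts it MODEL-false via a
manufactured-then-abandoned fat tube and records the refutation template. -/

/-- The level-1 HISTORY envelope of a design: forced classical flows `(u, p)` on `[0, τ₁]`, finite energy there, under
the level-0 ceiling on `[0, τ₀]` (= the stage's ceiling-0 clause; on a rigid design also its quiet clause), under the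
level-1 ceiling on `[0, τ₁]`, reading the level-0 letter at `τ₀` and the level-1 letter at `τ₁`. Every registered
level-1 stage's own flow lies in it (`historyEnvelopeOne_of_stage`). [cite: Palasek2026ElementaryModel, §3.3] -/
def HistoryEnvelopeOne (S : Schedule TowerRates.wide)
    (u : ℝ → EuclideanSpace ℝ (Fin 3) → EuclideanSpace ℝ (Fin 3)) (p : ℝ → EuclideanSpace ℝ (Fin 3) → ℝ) : Prop :=
  IsClassicalNSSolutionOn (Icc 0 (S.τ 1)) 1 S.f u p ∧
  (∃ C : ℝ≥0∞, C < ⊤ ∧ ∀ t ∈ Icc 0 (S.τ 1), ∫⁻ x, ‖u t x‖ₑ ^ 2 ≤ C) ∧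
  (∀ t ∈ Icc 0 (S.τ 0), ∀ x, ‖u t x‖ ≤ S.c₂ * TowerRates.wide.Y 0) ∧
  (∀ t ∈ Icc 0 (S.τ 1), ∀ x, ‖u t x‖ ≤ S.c₂ * TowerRates.wide.Y 1) ∧
  Letter S 0 (u (S.τ 0)) ∧ Letter S 1 (u (S.τ 1))

/-- **S⁺⁺ = HISTORY HEREDITY AT ONE (stage-free, schedule-light).** For every pinned rigid quiet wide design and every
flow in its level-1 history envelope: every tame free run of length `τ₂ − τ₁` from its `τ₁`-slice, inside the ceiling
`c₂ Y₂`, ends with the level-2 letter in the ball. CANDIDATE, never asserted. [cite: Palasek2026ElementaryModel, §4] -/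
@[conjecture] def HistoryHeredityAtOne : Prop :=
  ∀ S : Schedule TowerRates.wide, S.Pins 8 (6 / 5) → S.Rigid → S.Quiet →
    ∀ (u : ℝ → EuclideanSpace ℝ (Fin 3) → EuclideanSpace ℝ (Fin 3)) (p : ℝ → EuclideanSpace ℝ (Fin 3) → ℝ),
      HistoryEnvelopeOne S u p → SliceRun S 1 (fun S w => Letter S 2 w) (u (S.τ 1))

/-- Every registered level-1 stage's flow lies in the history envelope (its own `classical`, `energy`, `ceiling 0`,
`ceiling 1` clauses and `Letter.of_stage` at levels `0` and `1`). [cite: Palasek2026ElementaryModel, §3.3] -/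
theorem historyEnvelopeOne_of_stage {S : Schedule TowerRates.wide}
    (s : Stage 1 TowerRates.wide S (Margins.routeG TowerRates.wide) 1) : HistoryEnvelopeOne S s.u s.p :=
  ⟨s.classical, s.energy, fun t ht x => s.ceiling 0 (Nat.zero_le 1) t ht x,
    fun t ht x => s.ceiling 1 le_rfl t ht x, Letter.of_stage s (Nat.zero_le 1), Letter.of_stage s le_rfl⟩

/-- The `τ₁`-slice of a history-envelope flow lies in the level-1 (slice) envelope of S⁺. [folklore] -/
theorem sliceEnvelopeOne_of_historyEnvelopeOne {S : Schedule TowerRates.wide}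
    {u : ℝ → EuclideanSpace ℝ (Fin 3) → EuclideanSpace ℝ (Fin 3)} {p : ℝ → EuclideanSpace ℝ (Fin 3) → ℝ}
    (h : HistoryEnvelopeOne S u p) : SliceEnvelopeOne S (u (S.τ 1)) :=
  ⟨h.2.2.2.2.2, fun x => h.2.2.2.1 (S.τ 1) ⟨(S.τ_pos 1).le, le_rfl⟩ x⟩

/-- **S⁺ ⇒ S⁺⁺.** [cite: Palasek2026ElementaryModel, §4] -/
theorem historyHeredityAtOne_of_sliceHeredityAtOne (h : SliceHeredityAtOne) : HistoryHeredityAtOne :=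
  fun S hP hR hQ _ _ hE => h S hP hR hQ _ (sliceEnvelopeOne_of_historyEnvelopeOne hE)

/-- **S⁺⁺ ⇒ the lower three stubs** (via the slice form of the floors: instantiate at the registered stage's own
flow). [cite: Palasek2026ElementaryModel, §4] -/
theorem readoutFloorsAt_one_of_historyHeredityAtOne (h : HistoryHeredityAtOne) : ReadoutFloorsAt 1 :=
  readoutFloorsAt_one_iff_sliceRun.2 fun S hP hR hQ s => h S hP hR hQ _ _ (historyEnvelopeOne_of_stage s)

/-- S⁺⁺ ⇒ the three floor stubs, by name. [cite: Palasek2026ElementaryModel, §4] -/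
theorem floors_of_historyHeredityAtOne (h : HistoryHeredityAtOne) :
    SpeedFloorAt 1 ∧ StrainFloorAt 1 ∧ CoreFloorAt 1 :=
  readoutFloorsAt_iff_floors.1 (readoutFloorsAt_one_of_historyHeredityAtOne h)

/-- **S⁺⁺ + the upper stub ⇒ the crux.** [cite: Palasek2026ElementaryModel, §4] -/
theorem crux_of_apriori_historyHeredityAtOne (hA : AprioriCeilingAt 1) (h : HistoryHeredityAtOne) :
    PalasekTowerBreakdown.HeredityAtOne :=
  crux_iff_halves.2 ⟨hA, readoutFloorsAt_one_of_historyHeredityAtOne h⟩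

/-- **S⁺⁺ + the lead's register-free bound ⇒ the crux** (no registered stage in either hypothesis).
[cite: Palasek2026ElementaryModel, §4] -/
theorem crux_of_supGrowthBound_historyHeredity {M : ℝ}
    (hG : SupGrowthBound 1 (5 / 3 * TowerRates.wide.Y 1) (TowerRates.wide.window 1) M)
    (hM : M * (5 / 3 * TowerRates.wide.Y 1) ≤ 5 / 3 * TowerRates.wide.Y (1 + 1)) (h : HistoryHeredityAtOne) :
    PalasekTowerBreakdown.HeredityAtOne :=
  crux_of_apriori_historyHeredityAtOne (aprioriCeilingAt_of_supGrowthBound le_rfl hG hM) h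

/-- **The vacuity-free refutation template for S⁺⁺** (experiment E2's landing pad): ONE pinned rigid quiet wide design,
ONE history-envelope flow `(u, p)` (it need NOT be registered: no initial datum, no anchoring, no ledger — e.g. a fat
tube manufactured sub-ceiling by a strainer and then abandoned), and ONE tame free run from its `τ₁`-slice inside the
ceiling `c₂ Y₂` whose terminal slice is NOT a level-2 letter, refute `HistoryHeredityAtOne`.
[cite: Palasek2026ElementaryModel, §4] -/
theorem not_historyHeredityAtOne_of_abandoned_history
    (hW : ∃ (S : Schedule TowerRates.wide)
      (u : ℝ → EuclideanSpace ℝ (Fin 3) → EuclideanSpace ℝ (Fin 3)) (p : ℝ → EuclideanSpace ℝ (Fin 3) → ℝ)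
      (w : ℝ → EuclideanSpace ℝ (Fin 3) → EuclideanSpace ℝ (Fin 3)) (r : ℝ → EuclideanSpace ℝ (Fin 3) → ℝ),
      S.Pins 8 (6 / 5) ∧ S.Rigid ∧ S.Quiet ∧ HistoryEnvelopeOne S u p ∧
      IsClassicalNSSolutionOn (Icc 0 (S.τ 2 - S.τ 1)) 1 0 w r ∧ w 0 = u (S.τ 1) ∧
      (∃ C : ℝ≥0∞, C < ⊤ ∧ ∀ σ ∈ Icc 0 (S.τ 2 - S.τ 1), ∫⁻ x, ‖w σ x‖ₑ ^ 2 ≤ C) ∧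
      (∀ σ ∈ Icc 0 (S.τ 2 - S.τ 1), ∀ x, ‖w σ x‖ ≤ S.c₂ * TowerRates.wide.Y 2) ∧
      ¬ Letter S 2 (w (S.τ 2 - S.τ 1))) :
    ¬ HistoryHeredityAtOne := by
  intro h
  obtain ⟨S, u, p, w, r, hP, hR, hQ, hE, hw, hw0, hEn, hB, hnot⟩ := hW
  exact hnot (h S hP hR hQ u p hE w r hw hw0 hEn hB)

/-- **What a refutation of S⁺⁺ would show about the crux** (nothing against it; a location of its content): under the
crux, a history-envelope flow whose slice runs lazily is NOT the flow of any registered level-1 stage — i.e. the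
initial datum / anchoring / ledger (the MARGIN) is what any proof of the floors must use, beyond envelope and history.
[cite: Palasek2026ElementaryModel, §4] -/
theorem lazy_history_not_registered (h : PalasekTowerBreakdown.HeredityAtOne)
    {S : Schedule TowerRates.wide} (hP : S.Pins 8 (6 / 5)) (hR : S.Rigid) (hQ : S.Quiet)
    (s : Stage 1 TowerRates.wide S (Margins.routeG TowerRates.wide) 1)
    (hlazy : ¬ SliceRun S 1 (fun S w => Letter S 2 w) (s.u (S.τ 1))) : False :=
  hlazy (readoutFloorsAt_one_iff_sliceRun.1 (crux_iff_halves.1 h).2 S hP hR hQ s)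

end Summit.NavierStokesRegularity.NavierStokesRegularity.Cruxes.HeredityAtOne.StrategyCensusG2

end
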